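/-
Copyright (c) 2026 the pub-hodgecm-mathlib formalisation cell (harness21).  Prover seat hodgecm-mathlib-LH1-p01 (g12) on the N8-INNER road (row 2 `stub_N8`, road owner
LH2-plan (g1), DEAL #1 brick (5) «J′-TRANSPORT»), FILE A: the nondegenerate-frame twin of ★ `orbFamGExt_jumpGSideStatement` (LH3-p02 (g3), p850798); 2026-09-02.
-/
import Literature.NumberTheory.Rogawski1990.ArchOrbFamGExtJumpSideGStatement          -- ★ p850798 (LH3-p02 (g3)): the ANISOTROPIC-frame head `orbFamGExt_jumpGSideStatement` and, through it, every brick the body below calls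
import HarnessLib

/-!
# The organ-J `G′`-side head in the NONDEGENERATE diagonal frame (`α_i ≠ 0`, anisotropy NOT assumed): one test function per covered wall whose twisted extended orbital family
# jumps by `(i·C₁∕C₂)·(Cayley value)` with the Cayley value `≠ 0` (Shelstad 1979 §4 Prop. 4.5, Thm. 4.7; Rogawski 1990 §8.2 Prop. 8.2.1; Bouaziz 1994 §3.2 (I₃))

Topic `NumberTheory/Rogawski1990`; namespace `Literature.NumberTheory.Rogawski1990`.  THEOREMS ONLY (no definition, no instance, no notation, no axiom, no named fact, no `sorry`);
kernel lane `--kind proof --supports stmt-HodgeConjecture-24833`.  Cell `pub/hodgecm-mathlib`, crux H413 = `stmt-HodgeConjecture-24833`; N8-INNER road (LEAD F0P3a-plan (g15)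
T14-4 «§4 YES», road owner LH2-plan (g1) DEAL #1 2026-09-02T15:34:48Z), brick **(5) «J′-TRANSPORT»** («the jump constants of the `α`-atlas and of the `β`-atlas agree at the
indefinite places»), FILE A of two (FILE B = `ArchJumpConstInnerTransport`: the pins and the two-frame agreement head).  Author LH1-p01 (g12).

WHY.  The (I₃) jump constant of the extended `R′`-normalised orbital family `orbFamGExt L α ν′ a′` at a covered noncompact wall `(S, w, 0, 2)` is the CLOSED LITERAL `i·C₁∕C₂`
of the SHARED standard rank-one datum `(U(J), μ₀, μ₀′, C₁, C₂)` (★ `sharedRankOneDatum_exists`) — free of `S`, `w`, the wall point, the test function, and also of the frame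
`α` and of the Haar measure `ν′` (the descent constant cancels: ★ `ArchOrbFamGExtJumpWall02`, «`J = i·κ₀∕C′` depends on the datum only»).  A jump datum `jc′` valid for ALL test
functions (the letter-L1 ∕ CUT B output ★ `exists_jc_archHCSpaceG_orbFamGExt_of_ne_zero`) is therefore PINNED to that literal at every covered wall by ONE test function whose
Cayley value is non-zero (★ `jc'_eq_of_hasOneSidedJump`), and two such data — for the anisotropic inner form `G′_∞ = U(diag α)_∞` and for the quasi-split `G_∞ = U(Φ₃)_∞` read
in its ISOTROPIC diagonal frame `β = (½, 1, −½)` (★ `formCongr_quasiSplitFrame_diagonal`) — AGREE wall by wall.  The witness test function is ★ `orbFamGExt_jumpGSideStatement`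
(organ J of the `stub_N9` road), stated under the ANISOTROPY binder `hanis`, which its proof reads exactly once, as `hα : ∀ i, α i ≠ 0 := ne_zero_of_diagonal_anisotropic hanis`.
This file is its `hα`-TWIN, usable at `β` (`hherm` ✓, `hα` ✓ ★ `quasiSplitWeights_ne_zero`, `hanis` ✗) — the N8 ROAD CENSUS v0 (F0P3a-p02 (g22)) §4 CUT B pattern of ★
`ArchOrbFamGExtJumpNondeg` ∕ ★ `ArchHCOrbitalFamiliesNondeg` (LH10-p02 (g8)) applied to the organ-J side head: STATEMENT = the ★ statement token for token but for that one
binder; PROOF = the ★ body verbatim with the line `have hα := ne_zero_of_diagonal_anisotropic hanis` deleted; zero new analysis.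
* **`orbFamGExt_jumpGSideStatement_of_ne_zero`** — for every admissible chart `S`, covered place `w ∉ S` and `G`-semiregular point `s` of the wall `(w, 0, 2)`, given the
  letter-L1 smooth clause of every `orbFamGExt ν′ a′`, a smooth compactly supported `a′` on `U(diag α)_∞` whose twisted extended family along the wall normal jumps by
  `(i·C₁∕C₂) · (e^{ρ}_{S∪w}(cay) · orbFamGExt ν′ a′ (S∪w)(cay))`, Cayley value `≠ 0`.
HONEST LABEL: HC_CM is proved only modulo the 7 printed citations (2 remaining: hLiu418 = `stmt-HodgeConjecture-24832`, h413 = `stmt-HodgeConjecture-24833`) until rung 0 closes;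
count-neutral (no leaf, no letter, no books row moves; row 2 stays PRINT until (Sh)′ is ★).

## References
* [Shelstad1979] D. Shelstad, *Characters and inner forms of a quasi-split group over ℝ*, Compositio Math. 39 (1979), §4 Lemma 4.3 p. 25, Prop. 4.5 p. 26, Thm. 4.7 (IIIb) p. 31.
* [Rogawski1990] J. D. Rogawski, *Automorphic Representations of Unitary Groups in Three Variables*, Ann. of Math. Stud. 123 (1990), §4.12 Lemma 4.12.1 p. 61, §8.2 pp. 118–124; §14.2 p. 232.
* [Bouaziz1994IntegralesOrbitales] A. Bouaziz, *Intégrales orbitales sur les groupes de Lie réductifs*, Ann. Sci. ÉNS 27 (1994), §3.2 (I₃) p. 580, Rem. 2 p. 594.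
* [Varadarajan1989] V. S. Varadarajan, *An Introduction to Harmonic Analysis on Semisimple Lie Groups* (1989), §6.4 Thm 23.
-/

set_option autoImplicit false

noncomputable section

open MeasureTheory MeasureTheory.Measure NumberField NumberField.InfinitePlace Matrix Complex Set Filter Topology
open scoped MatrixGroups Matrix Real Classical ENNReal NNReal ContDiff
open Literature.NumberTheory.Automorphic Literature.NumberTheory.Automorphic.UnitaryGroup Literature.NumberTheory.Automorphic.ArchCartan
open Literature.NumberTheory.Automorphic.Shelstad1979.StableOrbitalIntegrals
open Literature.NumberTheory.GaloisRepresentations Literature.MeasureTheory.Group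

namespace Literature.NumberTheory.Rogawski1990

set_option maxHeartbeats 400000 in
/-- **THE ORGAN-J `G′`-SIDE HEAD IN THE NONDEGENERATE DIAGONAL FRAME — twin of ★ `orbFamGExt_jumpGSideStatement` with the anisotropy binder replaced by `∀ i, α i ≠ 0`.**
For a CM field `L`, a real diagonal frame `diag α` (`hherm`) with `α_i ≠ 0`, a Haar measure `ν′` on `U(diag α)_∞`, the SHARED rank-one datum `(U(J), μ₀, μ₀′, C₁, C₂)` with its
(K0±), (A0) and link texts: for every admissible chart `S`, covered place `w ∉ S` and `G`-semiregular point `s` of the wall `(w, 0, 2)`, given the letter-L1 smooth clause of every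
`orbFamGExt ν′ a′`, there is a smooth compactly supported `a′` whose twisted extended family along the wall normal jumps by `(i·C₁∕C₂) · (e^{ρ}_{S∪w}(cay) · orbFamGExt ν′ a′ (S∪w)(cay))`
with the Cayley value non-zero.  Proof = the ★ body verbatim (the line `have hα := ne_zero_of_diagonal_anisotropic hanis` deleted).
[cite: Shelstad1979, Prop. 4.5 (p. 26); Thm. 4.7 (IIIb) (p. 31)] [cite: Rogawski1990, §8.2 Prop. 8.2.1 (c) p. 119; §4.12 Lemma 4.12.1 p. 61]
[cite: Bouaziz1994IntegralesOrbitales, §3.2 (I₃) p. 580; Rem. 2 p. 594] [cite: Varadarajan1989, §6.4 Thm 23] -/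
theorem orbFamGExt_jumpGSideStatement_of_ne_zero :
  ∀ (L : Type) [Field L] [NumberField L] [IsCMField L] (α : Fin 3 → L)
    [MeasurableSpace (↥(arch (↥(maximalRealSubfield L)) L (IsCMField.complexConj L) 3 (Matrix.diagonal α)))] [BorelSpace (↥(arch (↥(maximalRealSubfield L)) L (IsCMField.complexConj L) 3 (Matrix.diagonal α)))]
    (ν' : Measure (↥(arch (↥(maximalRealSubfield L)) L (IsCMField.complexConj L) 3 (Matrix.diagonal α)))) [ν'.IsHaarMeasure] [ν'.IsMulRightInvariant],
    ((Matrix.diagonal α).map (cmConjRingHom L)).transpose = Matrix.diagonal α →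
    (∀ i, α i ≠ 0) →
    ∀ {J : Matrix (Fin 2) (Fin 2) ℂ} (hJ : J = (StdForm.antidiagonal 2).over ℂ)
      [MeasurableSpace ↥(unitaryGroupOfForm (starRingEnd ℂ) J)] [BorelSpace ↥(unitaryGroupOfForm (starRingEnd ℂ) J)]
      [LocallyCompactSpace ↥(unitaryGroupOfForm (starRingEnd ℂ) J)] [SecondCountableTopology ↥(unitaryGroupOfForm (starRingEnd ℂ) J)]
      [MeasurableSpace (↥(unitaryGroupOfForm (starRingEnd ℂ) J) ⧸ torusU (starRingEnd ℂ) J)] [BorelSpace (↥(unitaryGroupOfForm (starRingEnd ℂ) J) ⧸ torusU (starRingEnd ℂ) J)]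
      (μ₀ : Measure ↥(unitaryGroupOfForm (starRingEnd ℂ) J)) [μ₀.IsHaarMeasure] [μ₀.IsMulRightInvariant]
      (μ₀' : Measure (↥(unitaryGroupOfForm (starRingEnd ℂ) J) ⧸ torusU (starRingEnd ℂ) J)) [SMulInvariantMeasure ↥(unitaryGroupOfForm (starRingEnd ℂ) J) (↥(unitaryGroupOfForm (starRingEnd ℂ) J) ⧸ torusU (starRingEnd ℂ) J) μ₀'] [IsFiniteMeasureOnCompacts μ₀']
      (C₁ C₂ : ℝ), 0 < C₁ → 0 < C₂ →
      (∀ (f : Matrix (Fin 2) (Fin 2) ℂ → ℂ), Continuous f → HasCompactSupport f → ∀ z : Circle,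
        HasOneSidedJump (fun ψ : ℝ => (2 * Real.sin ψ : ℂ) *
            ∫ h : ↥(unitaryGroupOfForm (starRingEnd ℂ) J),
              f (((h * ⟨Matrix.GeneralLinearGroup.mkOfDetNeZero !![(1 : ℂ), 1; 1, -1] det_cayleyTwo_ne_zero *
                    circleDiagonal 2 ![z * Circle.exp ψ, z * Circle.exp (-ψ)] *
                    (Matrix.GeneralLinearGroup.mkOfDetNeZero !![(1 : ℂ), 1; 1, -1] det_cayleyTwo_ne_zero)⁻¹,
                  cayley_conj_circleDiagonal_mem_of_eq_over hJ _⟩ * h⁻¹ :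
                ↥(unitaryGroupOfForm (starRingEnd ℂ) J)) : GL (Fin 2) ℂ) : Matrix (Fin 2) (Fin 2) ℂ) ∂μ₀)
          ((C₁ : ℂ) * ((∫ p in Ioi (0 : ℝ) ×ˢ Ioc (0 : ℝ) (2 * π),
              f ((!![(1 : ℂ), 1; 1, -1] : Matrix (Fin 2) (Fin 2) ℂ) *
                ((z : ℂ) • (1 : Matrix (Fin 2) (Fin 2) ℂ) + p.1 • Matrix.diagonal ![(z : ℂ) * I, -((z : ℂ) * I)] +
                  p.1 • !![(0 : ℂ), -((z : ℂ) * I) * cexp (-((p.2 : ℂ) * I)); ((z : ℂ) * I) * cexp ((p.2 : ℂ) * I), 0]) *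
                !![(1 / 2 : ℂ), 1 / 2; 1 / 2, -(1 / 2)])) +
            ∫ p in Ioi (0 : ℝ) ×ˢ Ioc (0 : ℝ) (2 * π),
              f ((!![(1 : ℂ), 1; 1, -1] : Matrix (Fin 2) (Fin 2) ℂ) *
                ((z : ℂ) • (1 : Matrix (Fin 2) (Fin 2) ℂ) + p.1 • Matrix.diagonal ![-((z : ℂ) * I), (z : ℂ) * I] +
                  p.1 • !![(0 : ℂ), ((z : ℂ) * I) * cexp (-((p.2 : ℂ) * I)); -((z : ℂ) * I) * cexp ((p.2 : ℂ) * I), 0]) *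
                !![(1 / 2 : ℂ), 1 / 2; 1 / 2, -(1 / 2)])))) →
      (∀ (f : Matrix (Fin 2) (Fin 2) ℂ → ℂ), Continuous f → HasCompactSupport f → ∀ θ : ℝ,
      Tendsto (fun x : ℝ => |Real.exp x - Real.exp (-x)| •
          ∫ y, descConj (⟨hypBlockGL x θ, hypBlockGL_mem_of_eq_over hJ x θ⟩ : ↥(unitaryGroupOfForm (starRingEnd ℂ) J)) (torusU (starRingEnd ℂ) J)
            (LineRing.forall_mem_torusU_comm (starRingEnd ℂ) J (hypBlockGL_mem_torusU hJ x θ))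
            (fun g : ↥(unitaryGroupOfForm (starRingEnd ℂ) J) => f ((g : GL (Fin 2) ℂ) : Matrix (Fin 2) (Fin 2) ℂ)) y ∂μ₀')
        (𝓝[≠] 0)
        (𝓝 (C₂ • ((∫ p in Ioi (0 : ℝ) ×ˢ Ioc (0 : ℝ) (2 * π),
            f ((!![(1 : ℂ), 1; 1, -1] : Matrix (Fin 2) (Fin 2) ℂ) *
              (Complex.exp ((θ : ℂ) * Complex.I) • (1 : Matrix (Fin 2) (Fin 2) ℂ) +
                p.1 • Matrix.diagonal ![Complex.exp ((θ : ℂ) * Complex.I) * Complex.I, -(Complex.exp ((θ : ℂ) * Complex.I) * Complex.I)] +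
                p.1 • !![(0 : ℂ), -(Complex.exp ((θ : ℂ) * Complex.I) * Complex.I) * Complex.exp (-((p.2 : ℂ) * Complex.I));
                  (Complex.exp ((θ : ℂ) * Complex.I) * Complex.I) * Complex.exp ((p.2 : ℂ) * Complex.I), 0]) *
              !![(1 / 2 : ℂ), 1 / 2; 1 / 2, -(1 / 2)])) +
          ∫ p in Ioi (0 : ℝ) ×ˢ Ioc (0 : ℝ) (2 * π),
            f ((!![(1 : ℂ), 1; 1, -1] : Matrix (Fin 2) (Fin 2) ℂ) *
              (Complex.exp ((θ : ℂ) * Complex.I) • (1 : Matrix (Fin 2) (Fin 2) ℂ) +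
                p.1 • Matrix.diagonal ![-(Complex.exp ((θ : ℂ) * Complex.I) * Complex.I), Complex.exp ((θ : ℂ) * Complex.I) * Complex.I] +
                p.1 • !![(0 : ℂ), (Complex.exp ((θ : ℂ) * Complex.I) * Complex.I) * Complex.exp (-((p.2 : ℂ) * Complex.I));
                  -(Complex.exp ((θ : ℂ) * Complex.I) * Complex.I) * Complex.exp ((p.2 : ℂ) * Complex.I), 0]) *
              !![(1 / 2 : ℂ), 1 / 2; 1 / 2, -(1 / 2)]))))) →
      (∀ (ρ : Measure ↥(torusU (starRingEnd ℂ) J)) [ρ.IsHaarMeasure] [ρ.IsInvInvariant],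
    μ₀' = ρ ((fun p : ℝ × ℝ =>
        (⟨⟨hypBlockGL p.1 p.2, hypBlockGL_mem_of_eq_over hJ p.1 p.2⟩, hypBlockGL_mem_torusU hJ p.1 p.2⟩ : ↥(torusU (starRingEnd ℂ) J))) ''
          (Set.Icc (0 : ℝ) 1 ×ˢ Set.Icc (0 : ℝ) (2 * π))) •
      quotientMeasure (torusU (starRingEnd ℂ) J) ρ (LineRing.isClosed_torusU_two (starRingEnd ℂ) J) μ₀) →
    ∀ (S : Finset ({w : InfinitePlace L // IsComplex w})) (w : {w : InfinitePlace L // IsComplex w}) (s : {w : InfinitePlace L // IsComplex w} → Fin 3 → ℝ),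
      (∀ w' ∈ S, w' ∈ splitChartPlaces L α) → IsCoveredWall (slotSign L α) S w → w ∈ splitChartPlaces L α → HcSemireg S w 0 2 s →
      (∀ a' : ↥(arch (↥(maximalRealSubfield L)) L (IsCMField.complexConj L) 3 (Matrix.diagonal α)) → ℂ, ArchSmooth L 3 (Matrix.diagonal α) a' → ArchHcSmoothOneSided (slotSign L α) (orbFamGExt L α ν' a')) →
        ∃ a' : ↥(arch (↥(maximalRealSubfield L)) L (IsCMField.complexConj L) 3 (Matrix.diagonal α)) → ℂ, ArchSmooth L 3 (Matrix.diagonal α) a' ∧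
          HasOneSidedJump (fun ν : ℝ => archERhoG S (s + ν • hcNrm w 0 2) * orbFamGExt L α ν' a' S (s + ν • hcNrm w 0 2))
            ((I * C₁ / C₂ : ℂ) * (archERhoG (insert w S) (hcCayPt w 0 2 s) * orbFamGExt L α ν' a' (insert w S) (hcCayPt w 0 2 s))) ∧
          orbFamGExt L α ν' a' (insert w S) (hcCayPt w 0 2 s) ≠ 0 := by
  intro L _ _ _ α _ _ ν' _ _ hherm hα J hJ _ _ _ _ _ _ μ₀ _ _ μ₀' _ _ C₁ C₂ hC₁ hC₂ hK0 hA0 hlink S w₀ s hS hcov hwsp hp hsmAll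
  -- ### frame facts
  have hreal : ∀ (w : {w : InfinitePlace L // IsComplex w}) (i : Fin 3), (w.1.embedding (α i)).im = 0 :=
    fun w i => im_embedding_diagonal_eq_zero L 3 α (complexConj_apply_eq_of_diagonal_frame hherm) w i
  have hw₀ : w₀ ∉ S := hcov.1
  have hS' : ∀ w, w ∈ S → w ∈ splitChartPlaces L α := hS
  obtain ⟨hreal2, hsgn⟩ := blockWeights_of_mem_splitChartPlaces L α w₀ hwsp
  have hs02 : s w₀ 0 = s w₀ 2 := hp.1
  have h01 : Circle.exp (s w₀ 0) ≠ Circle.exp (s w₀ 1) := by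
    intro h; have h2 := hp.2.1; rw [hcThird_zero_two] at h2; exact h2 h.symm
  have hreg : ∀ w, w ≠ w₀ → w ∉ S → Function.Injective fun i : Fin 3 => Circle.exp (s w i) := fun w hne hw => hp.2.2.1 w hw hne
  have hregS : ∀ w, w ∈ S → s w 0 ≠ 0 := hp.2.2.2
  -- ### the test function: non-negative, real, `= 1` at the wall point (★ (N1′))
  obtain ⟨a', ha', ha's, ha'0, ha'1⟩ := exists_archSmooth_nonneg_eq_one_at L 3 (Matrix.diagonal α) (gprimeTorus L α S s)
  have ha'c : Continuous a' := ha'.continuous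
  have ha'pos : 0 < (a' (gprimeTorus L α S s)).re := by rw [ha'1]; exact zero_lt_one
  refine ⟨a', ha', ?_⟩
  -- ### (M-UNFOLD) on both charts (★ p850544), opened with `Exists.elim` (large goal)
  refine (exists_continuousMulEquiv_centralizer_gprimeTorus_semireg_cayley_torus L α S w₀ hα hS' hw₀ hwsp s hs02 h01 hreg hregS).elim fun K hK => hK.elim fun e he => ?_
  have hKc := he.1
  have hKcomm := he.2.2.1
  have h4 := he.2.2.2.1
  have h5 := he.2.2.2.2.1
  have h6 := he.2.2.2.2.2.1
  have hmapT := he.2.2.2.2.2.2.1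
  have h5β := he.2.2.2.2.2.2.2.2.2.2.1
  have h6β := he.2.2.2.2.2.2.2.2.2.2.2.1
  have h7β := he.2.2.2.2.2.2.2.2.2.2.2.2
  -- ### (B-STD) package: `φ`, `e′`, `Ψ` (★ `exists_std_package`)
  refine (exists_std_package L α w₀ hJ hreal2 hsgn e _ _ hmapT).elim fun φ hφ => hφ.elim fun e' hY => hY.elim fun Ψ hZ => ?_
  have hφ := hZ.1
  have hval := hZ.2.1
  have he' := hZ.2.2.1
  have hmapT' := hZ.2.2.2.1
  have hmem := hZ.2.2.2.2.1
  have hΨ := hZ.2.2.2.2.2.2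
  -- (B-STD) (iii) for this `φ`
  have hφβ : ∀ (cw : Fin 3 → ℝ) (h : ↥(unitaryGroupOfForm (starRingEnd ℂ) ((Matrix.diagonal ![α (lineOf (formSign L α w₀) 0), α (lineOf (formSign L α w₀) 2)]).map w₀.1.embedding))),
      (((h : ↥(unitaryGroupOfForm (starRingEnd ℂ) ((Matrix.diagonal ![α (lineOf (formSign L α w₀) 0), α (lineOf (formSign L α w₀) 2)]).map w₀.1.embedding))) : GL (Fin 2) ℂ) : Matrix (Fin 2) (Fin 2) ℂ) =
        (boostStd (formRe L α w₀ ∘ lineOf (formSign L α w₀)) cw).submatrix ![0, 2] ![0, 2] →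
      φ h = ⟨hypBlockGL (cw 0) (cw 2), hypBlockGL_mem_of_eq_over hJ (cw 0) (cw 2)⟩ := fun cw h hh =>
    std_eq_hypBlockGL_of_coe_eq_boost w₀.1.embedding ![α (lineOf (formSign L α w₀) 0), α (lineOf (formSign L α w₀) 2)] hJ hsgn φ hval
      (formRe L α w₀ ∘ lineOf (formSign L α w₀)) rfl rfl cw h hh
  -- ### the two chart tori sit inside `Z(γ_s)`
  have hT : chartTorusG L α S ≤ Subgroup.centralizer ({gprimeTorus L α S s} : Set ↥(arch (↥(maximalRealSubfield L)) L (IsCMField.complexConj L) 3 (Matrix.diagonal α))) :=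
    chartTorusG_le_centralizer L α S s
  have hTβ : chartTorusG L α (insert w₀ S) ≤ Subgroup.centralizer ({gprimeTorus L α S s} : Set ↥(arch (↥(maximalRealSubfield L)) L (IsCMField.complexConj L) 3 (Matrix.diagonal α))) := by
    have h := chartTorusG_le_centralizer L α (insert w₀ S) (Function.update s w₀ ![0, s w₀ 1, s w₀ 0])
    rwa [← gprimeTorus_of_wall L α hw₀ hwsp hs02] at h
  -- ### instances on `Z(γ_s)`, the two quotients, `U(J) ⧸ A_J`
  have hZc : IsClosed ((Subgroup.centralizer ({gprimeTorus L α S s} : Set ↥(arch (↥(maximalRealSubfield L)) L (IsCMField.complexConj L) 3 (Matrix.diagonal α)))) :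
      Set ↥(arch (↥(maximalRealSubfield L)) L (IsCMField.complexConj L) 3 (Matrix.diagonal α))) := isClosed_centralizer_singleton_of_t2 _
  haveI : LocallyCompactSpace ↥(Subgroup.centralizer ({gprimeTorus L α S s} : Set ↥(arch (↥(maximalRealSubfield L)) L (IsCMField.complexConj L) 3 (Matrix.diagonal α)))) := hZc.isClosedEmbedding_subtypeVal.locallyCompactSpace
  haveI : SecondCountableTopology ↥(Subgroup.centralizer ({gprimeTorus L α S s} : Set ↥(arch (↥(maximalRealSubfield L)) L (IsCMField.complexConj L) 3 (Matrix.diagonal α)))) := TopologicalSpace.Subtype.secondCountableTopology _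
  letI : MeasurableSpace (↥(Subgroup.centralizer ({gprimeTorus L α S s} : Set ↥(arch (↥(maximalRealSubfield L)) L (IsCMField.complexConj L) 3 (Matrix.diagonal α)))) ⧸ (chartTorusG L α S).subgroupOf (Subgroup.centralizer ({gprimeTorus L α S s} : Set ↥(arch (↥(maximalRealSubfield L)) L (IsCMField.complexConj L) 3 (Matrix.diagonal α))))) := borel _
  haveI : BorelSpace (↥(Subgroup.centralizer ({gprimeTorus L α S s} : Set ↥(arch (↥(maximalRealSubfield L)) L (IsCMField.complexConj L) 3 (Matrix.diagonal α)))) ⧸ (chartTorusG L α S).subgroupOf (Subgroup.centralizer ({gprimeTorus L α S s} : Set ↥(arch (↥(maximalRealSubfield L)) L (IsCMField.complexConj L) 3 (Matrix.diagonal α))))) := ⟨rfl⟩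
  letI : MeasurableSpace (↥(Subgroup.centralizer ({gprimeTorus L α S s} : Set ↥(arch (↥(maximalRealSubfield L)) L (IsCMField.complexConj L) 3 (Matrix.diagonal α)))) ⧸ (chartTorusG L α (insert w₀ S)).subgroupOf (Subgroup.centralizer ({gprimeTorus L α S s} : Set ↥(arch (↥(maximalRealSubfield L)) L (IsCMField.complexConj L) 3 (Matrix.diagonal α))))) := borel _
  haveI : BorelSpace (↥(Subgroup.centralizer ({gprimeTorus L α S s} : Set ↥(arch (↥(maximalRealSubfield L)) L (IsCMField.complexConj L) 3 (Matrix.diagonal α)))) ⧸ (chartTorusG L α (insert w₀ S)).subgroupOf (Subgroup.centralizer ({gprimeTorus L α S s} : Set ↥(arch (↥(maximalRealSubfield L)) L (IsCMField.complexConj L) 3 (Matrix.diagonal α))))) := ⟨rfl⟩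
  letI : MeasurableSpace (↥(unitaryGroupOfForm (starRingEnd ℂ) J) ⧸ Subgroup.map (φ : ↥(unitaryGroupOfForm (starRingEnd ℂ) ((Matrix.diagonal ![α (lineOf (formSign L α w₀) 0), α (lineOf (formSign L α w₀) 2)]).map w₀.1.embedding)) →* ↥(unitaryGroupOfForm (starRingEnd ℂ) J)) ((circleDiagonal 2).codRestrict (unitaryGroupOfForm (starRingEnd ℂ) ((Matrix.diagonal ![α (lineOf (formSign L α w₀) 0), α (lineOf (formSign L α w₀) 2)]).map w₀.1.embedding)) (circleDiagonal_mem_archLocal_diagonal L 2 ![α (lineOf (formSign L α w₀) 0), α (lineOf (formSign L α w₀) 2)] w₀)).range) := borel _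
  haveI : BorelSpace (↥(unitaryGroupOfForm (starRingEnd ℂ) J) ⧸ Subgroup.map (φ : ↥(unitaryGroupOfForm (starRingEnd ℂ) ((Matrix.diagonal ![α (lineOf (formSign L α w₀) 0), α (lineOf (formSign L α w₀) 2)]).map w₀.1.embedding)) →* ↥(unitaryGroupOfForm (starRingEnd ℂ) J)) ((circleDiagonal 2).codRestrict (unitaryGroupOfForm (starRingEnd ℂ) ((Matrix.diagonal ![α (lineOf (formSign L α w₀) 0), α (lineOf (formSign L α w₀) 2)]).map w₀.1.embedding)) (circleDiagonal_mem_archLocal_diagonal L 2 ![α (lineOf (formSign L α w₀) 0), α (lineOf (formSign L α w₀) 2)] w₀)).range) := ⟨rfl⟩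
  haveI : CompactSpace ↥(Subgroup.map (φ : ↥(unitaryGroupOfForm (starRingEnd ℂ) ((Matrix.diagonal ![α (lineOf (formSign L α w₀) 0), α (lineOf (formSign L α w₀) 2)]).map w₀.1.embedding)) →* ↥(unitaryGroupOfForm (starRingEnd ℂ) J)) ((circleDiagonal 2).codRestrict (unitaryGroupOfForm (starRingEnd ℂ) ((Matrix.diagonal ![α (lineOf (formSign L α w₀) 0), α (lineOf (formSign L α w₀) 2)]).map w₀.1.embedding)) (circleDiagonal_mem_archLocal_diagonal L 2 ![α (lineOf (formSign L α w₀) 0), α (lineOf (formSign L α w₀) 2)] w₀)).range) := isCompact_iff_compactSpace.mp (isCompact_map_circleDiagonal_range L α w₀ φ)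
  have hAcomm : ∀ a b : ↥(Subgroup.map (φ : ↥(unitaryGroupOfForm (starRingEnd ℂ) ((Matrix.diagonal ![α (lineOf (formSign L α w₀) 0), α (lineOf (formSign L α w₀) 2)]).map w₀.1.embedding)) →* ↥(unitaryGroupOfForm (starRingEnd ℂ) J)) ((circleDiagonal 2).codRestrict (unitaryGroupOfForm (starRingEnd ℂ) ((Matrix.diagonal ![α (lineOf (formSign L α w₀) 0), α (lineOf (formSign L α w₀) 2)]).map w₀.1.embedding)) (circleDiagonal_mem_archLocal_diagonal L 2 ![α (lineOf (formSign L α w₀) 0), α (lineOf (formSign L α w₀) 2)] w₀)).range), a * b = b * a := by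
    rintro ⟨_, ⟨x, ⟨u, rfl⟩, rfl⟩⟩ ⟨_, ⟨y, ⟨v, rfl⟩, rfl⟩⟩
    apply Subtype.ext
    show (φ : ↥(unitaryGroupOfForm (starRingEnd ℂ) ((Matrix.diagonal ![α (lineOf (formSign L α w₀) 0), α (lineOf (formSign L α w₀) 2)]).map w₀.1.embedding)) →* ↥(unitaryGroupOfForm (starRingEnd ℂ) J)) _ * (φ : ↥(unitaryGroupOfForm (starRingEnd ℂ) ((Matrix.diagonal ![α (lineOf (formSign L α w₀) 0), α (lineOf (formSign L α w₀) 2)]).map w₀.1.embedding)) →* ↥(unitaryGroupOfForm (starRingEnd ℂ) J)) _ =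
      (φ : ↥(unitaryGroupOfForm (starRingEnd ℂ) ((Matrix.diagonal ![α (lineOf (formSign L α w₀) 0), α (lineOf (formSign L α w₀) 2)]).map w₀.1.embedding)) →* ↥(unitaryGroupOfForm (starRingEnd ℂ) J)) _ * (φ : ↥(unitaryGroupOfForm (starRingEnd ℂ) ((Matrix.diagonal ![α (lineOf (formSign L α w₀) 0), α (lineOf (formSign L α w₀) 2)]).map w₀.1.embedding)) →* ↥(unitaryGroupOfForm (starRingEnd ℂ) J)) _
    rw [← map_mul, ← map_mul, ← map_mul, ← map_mul, mul_comm u v]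
  -- ### a right- and inversion-invariant Haar measure on `Z(γ_s)` ((h))
  obtain ⟨νM, hνM1, hνM2, hνM3⟩ := exists_isHaarMeasure_isMulRightInvariant_isInvInvariant_centralizer_arch (↥(maximalRealSubfield L)) L (IsCMField.complexConj L) 3
    (Matrix.diagonal α) ({gprimeTorus L α S s} : Set ↥(arch (↥(maximalRealSubfield L)) L (IsCMField.complexConj L) 3 (Matrix.diagonal α))) K hKc hKcomm e' μ₀
  haveI := hνM1; haveI := hνM2; haveI := hνM3
  -- ### the torus clauses `hγ` (★ p850492), `hγβ`, `hvert` (★ p850685)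
  have hγ := eM_gprimeTorus_add_smul_hcNrm_eq L α S w₀ s K e h5 h6 hJ φ (fun u _ => hφ u) e' he' hs02
  have hγβ := eM_gprimeTorus_insert_cayRay_eq L α S w₀ s hw₀ hwsp hs02 K e h6 (formRe L α w₀ ∘ lineOf (formSign L α w₀)) h5β h6β hJ φ hφβ e' he'
  have hvert := coe_symm_hypBlockGL_zero_eq_gprimeTorus L α S w₀ s hw₀ hwsp hs02 K e h6 (formRe L α w₀ ∘ lineOf (formSign L α w₀)) h5β h6β hJ φ hφβ e' he'
  -- [5β] through `φ` (LH3-p03's `h5β` binder)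
  have h5β' : ∀ c : {w : InfinitePlace L // IsComplex w} → Fin 3 → ℝ,
      (e' ⟨gprimeTorus L α (insert w₀ S) c, gprimeTorus_insert_mem_centralizer L α hw₀ hwsp hs02 c⟩).1 =
        ⟨hypBlockGL (c w₀ 0) (c w₀ 2), hypBlockGL_mem_of_eq_over hJ (c w₀ 0) (c w₀ 2)⟩ := fun c => by
    rw [he']
    exact hφβ (c w₀) _ (h5β c)
  -- ### the eventual binders on both charts (★ p850667, ★ p850695) and ONE cut-off `β` for both
  obtain ⟨CS, hCSc, hCMν, hintν⟩ := exists_blockNormal_binders L α S w₀ s ν' hα hreal hS' hw₀ hp ha'c ha's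
  obtain ⟨CB, hCBc, hCMx, hintx⟩ := exists_cayRay_binders L α S w₀ s ν' hα hS' hw₀ hwsp hp ha'c ha's
  obtain ⟨β, hβc, hβs, hβ0, hβpos', hβ1⟩ := exists_continuous_hasCompactSupport_integral_comp_mul_eq_one_pos
    (Subgroup.centralizer ({gprimeTorus L α S s} : Set ↥(arch (↥(maximalRealSubfield L)) L (IsCMField.complexConj L) 3 (Matrix.diagonal α)))) hZc νM
    ((hCSc.union hCBc).insert 1)
  have hβ1S : ∀ x ∈ CS, ∀ k₀ : ↥(Subgroup.centralizer ({gprimeTorus L α S s} : Set ↥(arch (↥(maximalRealSubfield L)) L (IsCMField.complexConj L) 3 (Matrix.diagonal α)))), ∫ h : ↥(Subgroup.centralizer ({gprimeTorus L α S s} : Set ↥(arch (↥(maximalRealSubfield L)) L (IsCMField.complexConj L) 3 (Matrix.diagonal α)))), β (x * (k₀ : ↥(arch (↥(maximalRealSubfield L)) L (IsCMField.complexConj L) 3 (Matrix.diagonal α))) *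
      (h : ↥(arch (↥(maximalRealSubfield L)) L (IsCMField.complexConj L) 3 (Matrix.diagonal α)))) ∂νM = 1 :=
    fun x hx k₀ => hβ1 x (Set.mem_insert_of_mem _ (Set.mem_union_left _ hx)) k₀
  have hβ1B : ∀ x ∈ CB, ∀ k₀ : ↥(Subgroup.centralizer ({gprimeTorus L α S s} : Set ↥(arch (↥(maximalRealSubfield L)) L (IsCMField.complexConj L) 3 (Matrix.diagonal α)))), ∫ h : ↥(Subgroup.centralizer ({gprimeTorus L α S s} : Set ↥(arch (↥(maximalRealSubfield L)) L (IsCMField.complexConj L) 3 (Matrix.diagonal α)))), β (x * (k₀ : ↥(arch (↥(maximalRealSubfield L)) L (IsCMField.complexConj L) 3 (Matrix.diagonal α))) *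
      (h : ↥(arch (↥(maximalRealSubfield L)) L (IsCMField.complexConj L) 3 (Matrix.diagonal α)))) ∂νM = 1 :=
    fun x hx k₀ => hβ1 x (Set.mem_insert_of_mem _ (Set.mem_union_right _ hx)) k₀
  have hβpos : ∃ h₀ : ↥(Subgroup.centralizer ({gprimeTorus L α S s} : Set ↥(arch (↥(maximalRealSubfield L)) L (IsCMField.complexConj L) 3 (Matrix.diagonal α)))), 0 < β (h₀ : ↥(arch (↥(maximalRealSubfield L)) L (IsCMField.complexConj L) 3 (Matrix.diagonal α))) :=
    ⟨1, by simpa using hβpos' 1 (Set.mem_insert _ _)⟩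
  -- ### a box-positive inversion-invariant Haar measure on the split torus, and `μ₀′ ≠ 0`
  have hTUc : IsClosed ((torusU (starRingEnd ℂ) J : Subgroup ↥(unitaryGroupOfForm (starRingEnd ℂ) J)) : Set ↥(unitaryGroupOfForm (starRingEnd ℂ) J)) :=
    LineRing.isClosed_torusU_two _ _
  haveI : LocallyCompactSpace ↥(torusU (starRingEnd ℂ) J) := hTUc.isClosedEmbedding_subtypeVal.locallyCompactSpace
  haveI : SecondCountableTopology ↥(torusU (starRingEnd ℂ) J) := TopologicalSpace.Subtype.secondCountableTopology _
  obtain ⟨σ, hσ⟩ : ∃ σ : Measure ↥(torusU (starRingEnd ℂ) J), σ.IsHaarMeasure := ⟨Measure.haar, inferInstance⟩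
  haveI : σ.IsInvInvariant := isInvInvariant_of_comm _ hTUc (fun x hx y hy => LineRing.forall_mem_torusU_comm (starRingEnd ℂ) J hy x hx) σ
  have hσ0 := measure_boxStd_ne_zero hJ σ
  have hσt := (measure_boxStd_lt_top hJ σ).ne
  have hμ₀' : μ₀' ≠ 0 := by
    intro h0
    have hQ := quotientMeasure_ne_zero (torusU (starRingEnd ℂ) J) σ (LineRing.isClosed_torusU_two (starRingEnd ℂ) J) μ₀
    apply hQ
    have h := hlink σ
    rw [h0] at h
    have hu := congrArg (fun m : Measure (↥(unitaryGroupOfForm (starRingEnd ℂ) J) ⧸ torusU (starRingEnd ℂ) J) => m Set.univ) h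
    simp only [Measure.coe_zero, Pi.zero_apply, Measure.smul_apply, smul_eq_mul] at hu
    exact Measure.measure_univ_eq_zero.1 ((mul_eq_zero.1 hu.symm).resolve_left hσ0)
  -- ### (b2) the Cayley torus bookkeeping: `e′(T♯′) = T_split × ⊤`, `Ψβ`, `hTAβ` (★ p850743)
  obtain ⟨hTAβ, -, Ψβ, -, hΨβ⟩ := hTAβ_package_semireg_std L α S w₀ hw₀ hwsp s hs02 K e h5β h7β hJ hsgn φ hval e' he'
  have hTA : ∀ g : ↥(Subgroup.centralizer ({gprimeTorus L α S s} : Set ↥(arch (↥(maximalRealSubfield L)) L (IsCMField.complexConj L) 3 (Matrix.diagonal α)))), g ∈ (chartTorusG L α S).subgroupOf (Subgroup.centralizer ({gprimeTorus L α S s} : Set ↥(arch (↥(maximalRealSubfield L)) L (IsCMField.complexConj L) 3 (Matrix.diagonal α)))) ↔ (e' g).1 ∈ Subgroup.map (φ : ↥(unitaryGroupOfForm (starRingEnd ℂ) ((Matrix.diagonal ![α (lineOf (formSign L α w₀) 0), α (lineOf (formSign L α w₀) 2)]).map w₀.1.embedding)) →* ↥(unitaryGroupOfForm (starRingEnd ℂ)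 J)) ((circleDiagonal 2).codRestrict (unitaryGroupOfForm (starRingEnd ℂ) ((Matrix.diagonal ![α (lineOf (formSign L α w₀) 0), α (lineOf (formSign L α w₀) 2)]).map w₀.1.embedding)) (circleDiagonal_mem_archLocal_diagonal L 2 ![α (lineOf (formSign L α w₀) 0), α (lineOf (formSign L α w₀) 2)] w₀)).range :=
    fun g => mem_iff_fst_mem_of_map_eq_prod_top _ _ e' hmapT' g
  -- ### (G′-CANCEL): the two descent constants against the shared `μ₀`, `μ₀′` AGREE (★ p850673)
  obtain ⟨κ, κβ, hκ, hκβ, hmap, hmapβ, hKK⟩ := exists_hmap_hmapβ_descentConst_eq_of_clauses L α S w₀ s hw₀ hwsp hs02 hT hTβ νM hJ μ₀ μ₀' hlink σ hσ0 hσt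
    (Subgroup.map (φ : ↥(unitaryGroupOfForm (starRingEnd ℂ) ((Matrix.diagonal ![α (lineOf (formSign L α w₀) 0), α (lineOf (formSign L α w₀) 2)]).map w₀.1.embedding)) →* ↥(unitaryGroupOfForm (starRingEnd ℂ) J)) ((circleDiagonal 2).codRestrict (unitaryGroupOfForm (starRingEnd ℂ) ((Matrix.diagonal ![α (lineOf (formSign L α w₀) 0), α (lineOf (formSign L α w₀) 2)]).map w₀.1.embedding)) (circleDiagonal_mem_archLocal_diagonal L 2 ![α (lineOf (formSign L α w₀) 0), α (lineOf (formSign L α w₀) 2)] w₀)).range) hAcomm K hKc hKcomm e h4 h5 h6 h6β φ e' he' h5β' hTA hTAβ Ψ hΨ Ψβ hΨβ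
  -- ### (J-G′-BLOCK) on the compact chart: ONE block test function `f_B` and `hdesc` (★ p850417)
  refine (exists_block_testFunction_chartOrbG_eventuallyEq L α ν' a' S w₀ s (gprimeTorus L α S s) hT (Subgroup.map (φ : ↥(unitaryGroupOfForm (starRingEnd ℂ) ((Matrix.diagonal ![α (lineOf (formSign L α w₀) 0), α (lineOf (formSign L α w₀) 2)]).map w₀.1.embedding)) →* ↥(unitaryGroupOfForm (starRingEnd ℂ) J)) ((circleDiagonal 2).codRestrict (unitaryGroupOfForm (starRingEnd ℂ) ((Matrix.diagonal ![α (lineOf (formSign L α w₀) 0), α (lineOf (formSign L α w₀) 2)]).map w₀.1.embedding)) (circleDiagonal_mem_archLocal_diagonal L 2 ![α (lineOf (formSign L α w₀) 0), α (lineOf (formSign L α w₀) 2)] w₀)).range) e' Ψ hΨ μ₀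
    (fun ν : ℝ => (⟨Matrix.GeneralLinearGroup.mkOfDetNeZero !![(1 : ℂ), 1; 1, -1] det_cayleyTwo_ne_zero *
        circleDiagonal 2 ![Circle.exp (s w₀ 0) * Circle.exp ν, Circle.exp (s w₀ 0) * Circle.exp (-ν)] *
        (Matrix.GeneralLinearGroup.mkOfDetNeZero !![(1 : ℂ), 1; 1, -1] det_cayleyTwo_ne_zero)⁻¹, cayley_conj_circleDiagonal_mem_of_eq_over hJ _⟩ : ↥(unitaryGroupOfForm (starRingEnd ℂ) J)))
    (e ⟨gprimeTorus L α S s, gprimeTorus_mem_centralizer L α S s s⟩).2 hγ νM ha'c ha's hβc hβs hβ0 hβ1S hCMν hintν hmap).elim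
    fun fB hfB => ?_
  have hfBc := hfB.1
  have hfBs := hfB.2.1
  have hfBdef := hfB.2.2.1
  have hdesc := hfB.2.2.2
  -- an ambient extension `f` of `f_B` (Tietze, ★ p850353) and the (K0) jump from the SHARED `(μ₀, C₁)` (★ §5)
  obtain ⟨f, hf, hfc, hfF⟩ := exists_continuous_hasCompactSupport_extend hJ fB hfBc hfBs
  have hjump := hasOneSidedJump_two_sin_mul_integral_block_of_sharedK0 hJ μ₀ hK0 fB f hf hfc hfF (s w₀ 0)
  have hfF' : ∀ g : ↥(unitaryGroupOfForm (starRingEnd ℂ) J), f ((g : GL (Fin 2) ℂ) : Matrix (Fin 2) (Fin 2) ℂ) =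
      (fun m : ↥(Subgroup.centralizer ({gprimeTorus L α S s} : Set ↥(arch (↥(maximalRealSubfield L)) L (IsCMField.complexConj L) 3 (Matrix.diagonal α)))) => ∫ x', β x' • a' (x' * (m : ↥(arch (↥(maximalRealSubfield L)) L (IsCMField.complexConj L) 3 (Matrix.diagonal α))) * x'⁻¹) ∂ν')
        (e'.symm (g, (e ⟨gprimeTorus L α S s, gprimeTorus_mem_centralizer L α S s s⟩).2)) := fun g => by
    rw [hfF, hfBdef]
  -- ### the Cayley-chart limit `hray` and its non-vanishing, in the SHARED currency (★ p850689)
  have hray := tendsto_absSub_mul_chartOrbG_xRay_descended_of_cutoff_shared L α ν' a' S w₀ s (gprimeTorus L α S s) hTβ hJ μ₀' e' Ψβ hΨβ (s w₀ 0)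
    (e ⟨gprimeTorus L α S s, gprimeTorus_mem_centralizer L α S s s⟩).2 hγβ νM ha'c ha's hβc hβs hβ0 hβ1B hCMx hintx hmapβ hA0 f hf hfc hfF'
  have hdtS := toReal_chartHaarG_chartBoxImgG_pos L α S hα hS'
  have hdtB := toReal_chartHaarG_chartBoxImgG_pos L α (insert w₀ S) hα (insert_subset_splitChartPlaces L α hS' hwsp)
  have hKβ0 : (((haveI := isHaarMeasure_chartHaarG L α (insert w₀ S); chartHaarG L α (insert w₀ S) (chartBoxImgG L α (insert w₀ S)))).toReal : ℂ) * ((κβ : ℝ) : ℂ) ≠ 0 :=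
    mul_ne_zero (Complex.ofReal_ne_zero.2 hdtB.ne') (Complex.ofReal_ne_zero.2 (NNReal.coe_ne_zero.2 hκβ))
  have hK0' : (((haveI := isHaarMeasure_chartHaarG L α S; chartHaarG L α S (chartBoxImgG L α S))).toReal : ℂ) * ((κ : ℝ) : ℂ) ≠ 0 :=
    mul_ne_zero (Complex.ofReal_ne_zero.2 hdtS.ne') (Complex.ofReal_ne_zero.2 (NNReal.coe_ne_zero.2 hκ))
  have hΛne := mul_sharedCone_blockTestFunction_ne_zero L α ν' a' (gprimeTorus L α S s) hJ μ₀' e' (s w₀ 0)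
    (e ⟨gprimeTorus L α S s, gprimeTorus_mem_centralizer L α S s s⟩).2 hμ₀' hvert hβc hβs hβ0 hβpos ha'c ha's ha'0 ha'pos hA0 f hf hfc hfF' hKβ0
  have hcone := right_ne_zero_of_mul (right_ne_zero_of_mul hΛne)
  -- ### ONE descent constant: `dt′_S·κ = dt′♯·κβ` ((G′-CANCEL))
  have hKK' : (((haveI := isHaarMeasure_chartHaarG L α (insert w₀ S); chartHaarG L α (insert w₀ S) (chartBoxImgG L α (insert w₀ S)))).toReal : ℂ) * ((κβ : ℝ) : ℂ) =
      (((haveI := isHaarMeasure_chartHaarG L α S; chartHaarG L α S (chartBoxImgG L α S))).toReal : ℂ) * ((κ : ℝ) : ℂ) := by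
    rw [← Complex.ofReal_mul, ← Complex.ofReal_mul, hKK]
  -- ### the (JG′) head (★ p850473 §6), read by continuity from the ray
  exact hasOneSidedJump_orbFamGExt_side_of_bricks_of_cayRay_std L α ν' a' hS' hw₀ hwsp hp hdesc hjump rfl (by rw [hKK']) hcone hK0' hC₂.ne'
    (hsmAll a' ha' (insert w₀ S)).1 hray

end Literature.NumberTheory.Rogawski1990

end
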